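/-
Copyright (c) 2026 the pub-hodgecm-mathlib formalisation cell (harness21).  Prover seat hodgecm-mathlib-K2Liu-p07 (g3), Track B «K2-LIT»,
#184♮ = hLiu418 = `stmt-HodgeConjecture-24832`; #42S payer road, organ S1 (local Siegel–Weil spanning), ROAD W letter (R-d) = (ii-gen), existence half
(LEAD F0P6-plan (g14) BATCH #16 (2) «(R-d) (ii-gen) = p07»; K2Liu-p01 (g8) SPEC-F7-FrameStep §2 (ii)).
-/
import Literature.NumberTheory.QuadraticForms.QuadraticFormIsotropicOfFiveLe     -- ★ `not_anisotropic_of_five_le_finrank_adicCompletion` (u-invariant ≤ 4)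
import Literature.NumberTheory.Automorphic.QuadraticLocalBaseChange               -- ★ `LocalRing`, `toLocalRing`, `conjLocal`
import HarnessLib

/-!
# Crux `HLiu418`, #42S organ S1, ROAD W, letter (ii-gen) — existence half: EVERY TERNARY HERMITIAN SPACE OVER `E ⊗_F F_v` IS ISOTROPIC

Cell `hodgecm-mathlib`, crux item hLiu418 = `stmt-HodgeConjecture-24832`; squad K2 ∕ K2Liu; LEAD F0P6-plan (g14), organ lead K2Liu-p06 (g4);
prover K2Liu-p07 (g3).  THEOREMS ONLY (no `def`, no instance, no notation, no named-fact hypothesis, no `sorry`); lane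
`--supports stmt-HodgeConjecture-24832 --as helper`.

WHY.  The ROAD-W witnesses (all three hands: inert F7, ramified F7r, split F8) are lattice pairs written in a basis `(u, u′, ℓ)` of the ternary hermitian space
`V′_w` with Gram `[[0,1,0],[1,0,0],[0,0,d′]]` (★ F7c-B ∕ ★ (T3-core)).  K2Liu-p01 (g8)'s ★ (ii-a) `K2LiuHyperbolicPairOfIsotropicNorm` builds such a basis from an
isotropic norm equation INSIDE A COORDINATE PLANE (`d_i·λσλ + d_j = 0`) — available at inert unramified places by a parity argument, NOT at a ramified place with
`d₁ ≡ d₂ ≡ d₃ (mod N)` and `−1 ∉ N`.  The general input is an ISOTROPIC VECTOR of the whole ternary space, which always exists at a finite place: the form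
`y ↦ Σ_k d_k · y_k σ(y_k)` read on `E_w ≅ F_v ⊕ F_v·δ` (`δ² = θ`, `σδ = −δ`) is the SIX-dimensional quadratic form `Σ_k d_k (x_{k0}² − θ x_{k1}²)` over `F_v`,
isotropic because the u-invariant of a finite completion of a number field is `4` (★ `not_anisotropic_of_five_le_finrank_adicCompletion`, all residue
characteristics).  This file is that existence statement, in the `E ⊗_F F_v = ∏_{w∣v} E_w` currency of the organ (★ `QuadraticLocalBaseChange`: `toLocalRing`,
`conjLocal`); the frame construction from an isotropic vector (any position) is the sequel `K2LiuHyperbolicFrameOfIsotropic` (field algebra, dyadic-safe via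
K2Liu-p01's trace-one letter `t₀ + σt₀ = 1`).
* `localRing_norm_eq` — `(ι a + ι b·δ)·σ(ι a + ι b·δ) = ι(a² − θ b²)`;  `eq_zero_of_add_mul_delta_eq_zero` — `ι a + ι b·δ = 0 ⇒ a = b = 0`;
* **`exists_isotropic_localRing`** — for `δ ∈ E` with `σδ = −δ ≠ 0`, `δ² = θ ∈ F`, and any `d₁, d₂, d₃ ∈ F_v`: `∃ y : Fin 3 → E ⊗ F_v`, `y ≠ 0`,
  `Σ_k ι(d_k)·y_k·σ(y_k) = 0`.
References: [Lam2005] Ch. VI Thm. 2.12; [Serre1973] Ch. IV §2.2 Thm. 6; [Scharlau1985HermitianForms] Ch. 7 §6; [Jacobowitz1962] §4.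
HONEST LABEL.  Count-neutral helper: `HC_CM` is proved only modulo the 7 printed citations (2 remaining named inputs: hLiu418 = `stmt-HodgeConjecture-24832`,
h413 = `stmt-HodgeConjecture-24833`) until rung 0 closes.
-/

set_option autoImplicit false
set_option linter.dupNamespace false -- the mandated namespace repeats `HodgeConjecture.HodgeConjecture`

noncomputable section

open NumberField IsDedekindDomain
open Literature.NumberTheory.Automorphic Literature.NumberTheory.Automorphic.UnitaryGroup Literature.NumberTheory.QuadraticForms

namespace Summit.HodgeConjecture.HodgeConjecture.Cruxes.HLiu418.K2LiuIsotropicVectorLocal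

variable {F : Type} [Field F] [NumberField F] {E : Type} [Field E] [NumberField E] [Algebra F E]
  (σ : E ≃ₐ[F] E) {δ : E} (hσδ : σ δ = -δ) (hδ : δ ≠ 0) {θ : F} (hθ : δ * δ = algebraMap F E θ)
  (v : HeightOneSpectrum (𝓞 F))

/-! ## §1 The norm form in `E ⊗_F F_v`-letters -/

include hσδ hθ in
/-- **`(ι a + ι b·δ)·σ(ι a + ι b·δ) = ι(a² − θ b²)`** in `E ⊗_F F_v` (`ι = toLocalRing`, `δ² = θ`, `σδ = −δ`). [cite: Scharlau1985HermitianForms, Ch. 7 §6] -/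
theorem localRing_norm_eq (a b : v.adicCompletion F) :
    (toLocalRing E v a + toLocalRing E v b * algebraMap E (LocalRing E v) δ) *
        conjLocal E σ v (toLocalRing E v a + toLocalRing E v b * algebraMap E (LocalRing E v) δ) =
      toLocalRing E v (a ^ 2 - θ * b ^ 2) := by
  have hδ2 : algebraMap E (LocalRing E v) δ * algebraMap E (LocalRing E v) δ = toLocalRing E v (θ : v.adicCompletion F) := by
    rw [← map_mul, hθ, toLocalRing_coe]
  rw [map_add, map_mul, conjLocal_toLocalRing, conjLocal_toLocalRing, conjLocal_algebraMap, hσδ, map_neg, map_sub, map_pow, map_mul, map_pow,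
    ← hδ2]
  ring

include hσδ hδ in
/-- **`{1, δ}` is free over `ι(F_v)`**: `ι a + ι b·δ = 0 ⇒ a = 0 ∧ b = 0` (apply `σ ⊗ 1`, `δ ↦ −δ`; characteristic `0`; `δ_w ≠ 0` at every `w ∣ v`). [folklore] -/
theorem eq_zero_of_add_mul_delta_eq_zero {a b : v.adicCompletion F}
    (h : toLocalRing E v a + toLocalRing E v b * algebraMap E (LocalRing E v) δ = 0) : a = 0 ∧ b = 0 := by
  haveI : CharZero (v.adicCompletion F) := charZero_of_injective_algebraMap (algebraMap F (v.adicCompletion F)).injective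
  have h' : toLocalRing E v a - toLocalRing E v b * algebraMap E (LocalRing E v) δ = 0 := by
    have := congrArg (conjLocal E σ v) h
    rwa [map_add, map_mul, conjLocal_toLocalRing, conjLocal_toLocalRing, conjLocal_algebraMap, hσδ, map_neg, map_zero, mul_neg, ← sub_eq_add_neg] at this
  have ha : toLocalRing E v (2 * a) = 0 := by
    rw [map_mul, map_ofNat, two_mul]
    linear_combination h + h'
  have ha0 : a = 0 := by
    have h2 : (2 : v.adicCompletion F) * a = 0 := (toLocalRing E v).injective (by rw [ha, map_zero])
    rcases mul_eq_zero.1 h2 with h2 | h2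
    · exact absurd h2 two_ne_zero
    · exact h2
  refine ⟨ha0, ?_⟩
  rw [ha0, map_zero, zero_add] at h
  have hb : ∀ w : PlacesOver E v, toLocalRing E v b w = 0 := fun w => by
    have hw := congrFun h w
    rw [Pi.mul_apply, Pi.zero_apply, mul_eq_zero] at hw
    rcases hw with hw | hw
    · exact hw
    · exact absurd hw (by
        change ((δ : E) : w.1.adicCompletion E) ≠ 0
        exact (map_ne_zero (algebraMap E (w.1.adicCompletion E))).2 hδ)
  exact (toLocalRing E v).injective (by rw [map_zero]; exact funext hb)

/-! ## §2 The isotropic vector -/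

include hσδ hδ hθ in
/-- **EVERY TERNARY HERMITIAN SPACE OVER `E ⊗_F F_v` IS ISOTROPIC**: for `d₁, d₂, d₃ ∈ F_v` there is `y ∈ (E ⊗ F_v)³`, `y ≠ 0`, with `Σ_k ι(d_k)·y_k·σ(y_k) = 0`
— the six-dimensional quadratic form `Σ_k d_k (x_{k0}² − θ x_{k1}²)` over `F_v` is isotropic (u-invariant `4`: ★ `not_anisotropic_of_five_le_finrank_adicCompletion`) and
`y_k := ι x_{k0} + ι x_{k1}·δ`.  (No non-degeneracy or place hypothesis: at a split `v` the statement is about the product ring.) [cite: Lam2005, Ch. VI Thm. 2.12]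
[cite: Scharlau1985HermitianForms, Ch. 7 §6] [cite: Jacobowitz1962, §4] -/
theorem exists_isotropic_localRing (d : Fin 3 → v.adicCompletion F) :
    ∃ y : Fin 3 → LocalRing E v, y ≠ 0 ∧ ∑ k, toLocalRing E v (d k) * y k * conjLocal E σ v (y k) = 0 := by
  -- the six-dimensional quadratic form over `F_v`
  set w : Fin 3 × Fin 2 → v.adicCompletion F := fun p => if p.2 = 0 then d p.1 else -(d p.1 * (θ : v.adicCompletion F)) with hw
  have h6 : 5 ≤ Module.finrank (v.adicCompletion F) (Fin 3 × Fin 2 → v.adicCompletion F) := by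
    rw [Module.finrank_fintype_fun_eq_card, Fintype.card_prod, Fintype.card_fin, Fintype.card_fin]
    norm_num
  have hQ := not_anisotropic_of_five_le_finrank_adicCompletion F v (QuadraticMap.weightedSumSquares (v.adicCompletion F) w) h6
  unfold QuadraticMap.Anisotropic at hQ
  push Not at hQ
  obtain ⟨x, hx, hx0⟩ := hQ
  refine ⟨fun k => toLocalRing E v (x (k, 0)) + toLocalRing E v (x (k, 1)) * algebraMap E (LocalRing E v) δ, ?_, ?_⟩
  · -- `y ≠ 0`
    intro hy
    apply hx0
    funext p
    obtain ⟨k, j⟩ := p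
    have hk := eq_zero_of_add_mul_delta_eq_zero σ hσδ hδ v (congrFun hy k)
    fin_cases j
    · exact hk.1
    · exact hk.2
  · -- the hermitian form is `ι(Q x) = 0`
    have hterm : ∀ k : Fin 3, toLocalRing E v (d k) * (toLocalRing E v (x (k, 0)) + toLocalRing E v (x (k, 1)) * algebraMap E (LocalRing E v) δ) *
        conjLocal E σ v (toLocalRing E v (x (k, 0)) + toLocalRing E v (x (k, 1)) * algebraMap E (LocalRing E v) δ) =
        toLocalRing E v (d k * (x (k, 0) ^ 2 - θ * x (k, 1) ^ 2)) := fun k => by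
      rw [mul_assoc, localRing_norm_eq σ hσδ hθ v, ← map_mul]
    simp_rw [hterm]
    rw [← map_sum]
    have hQx : ∑ k : Fin 3, d k * (x (k, 0) ^ 2 - θ * x (k, 1) ^ 2) = QuadraticMap.weightedSumSquares (v.adicCompletion F) w x := by
      rw [QuadraticMap.weightedSumSquares_apply, Fintype.sum_prod_type]
      refine Finset.sum_congr rfl fun k _ => ?_
      rw [Fin.sum_univ_two, hw]
      simp only [Fin.isValue, ↓reduceIte, one_ne_zero, smul_eq_mul]
      ring
    rw [hQx, hx, map_zero]

end Summit.HodgeConjecture.HodgeConjecture.Cruxes.HLiu418.K2LiuIsotropicVectorLocal
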